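import Summits.ResolutionOfSingularities.ResolutionOfSingularities.Theses.Valuative
import Summits.ResolutionOfSingularities.ResolutionOfSingularities.Theorems.ValuativeLuAlphaPTorsorPthPowerModMonomialInduction
import Summits.ResolutionOfSingularities.ResolutionOfSingularities.Theorems.ValuativeLuAlphaPTorsorPthPowerModMonomialRichness

/-!
# `p`-th powers modulo a monomial (crux `Valuative.LuAlphaPTorsor`, line `pfaff-line-log-final-forms`)

Stub `stub_pthPowerModMonomial` of the lead's skeleton
`Cruxes/LuAlphaPTorsor/Lines/pfaff-line-log-final-forms.lean` (item
`stmt-ResolutionOfSingularities-0641`), PROVED.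

Setting: `R = A_𝔭` the local ring of a finitely generated `k`-subalgebra `A ⊆ O ⊆ K` of a
valued field at the centre `𝔭 = 𝔪_O ∩ A`, ASSUMED regular, of dimension `d`, with a regular
system of parameters `u : Fin d → R` (`(u) = 𝔪`, `dim R = d`), a boundary `E ⊆ Fin d` and
exponents `M`; `char k = p > 0`. If every `ℤ`-derivation `δ` of `R` logarithmic along the boundary
(`δ u_i ∈ (u_i)` for `i ∈ E`) has `δ a ∈ (∏_{i∈E} u_i^{M_i})`, then `a ≡ c^p mod ∏_{i∈E} u_i^{M_i}`.

Proof (files `ValuativeLuAlphaPTorsorPthPowerModMonomial{Helpers,Induction,Jacobian,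
Presentation,Richness}.lean`):

1. **Supply of derivations** (`Jacobian`, `Presentation`, `Richness`). Present `R` as a quotient
   `Φq : S_𝔮 ↠ R` of a localized polynomial ring `S = k[X_1, …, X_n]` (`A = k[x_1, …, x_n]`).
   Since `R` and `S_𝔮` are regular, `ker Φq = (g_1, …, g_c)` with `dg_i` independent in `𝔫/𝔫²`
   (Matsumura 14.2), and with lifts `F_j` of (unit multiples of) the `u_j` the classes of
   `g_1, …, g_c, F_1, …, F_d` are independent. Zariski–Matsumura (proof of Thm. 30.5, through
   Cohen's coefficient field of `S_𝔮/𝔫²` and a basis of `Ω_{k/ℤ}`) gives `D_l ∈ Der(S)` with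
   `(D_l g'_m) ≡ c₀ · 1 mod 𝔮`; inverting this matrix over `S_𝔮` yields derivations dual to
   `(g, F)`, of which the last `d` descend to DUAL DERIVATIONS `D_i ∈ Der_ℤ(R)`, `D_i u'_j = δ_ij`
   (`u'_j = Φ F_j`). Moreover every `ψ`-derivation `R → N` is, on finitely many elements, a
   finite combination `∑ ψ(Δ_j ·) n_j` of `ℤ`-derivations of `R` (expand along `∂/∂X_l` and the
   dual derivations of a finite `p`-free set of constants, Matsumura §26, and transport).
2. **Base case** (`Induction.exists_sub_pow_mem_of_rich`): if all log-derivatives of `x` lie in `(u_{i₀})` then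
   `x ≡ c^p mod u_{i₀}` — `R/(u_{i₀})` is regular, hence normal, so a non-`p`-th power stays a
   non-`p`-th power in the fraction field `L`, where a derivation detects it (Zorn along
   `p`-th root extensions); pulled back and expanded it would be a combination of LOG derivations
   all vanishing at `x` modulo `u_{i₀}`.
3. **Induction on `|M|`** (`Induction.exists_sub_pow_mem_span_uPow`) with the Euler identities
   `u_i D_i(u^N b) = u^N (N_i b + u_i D_i b)`, the colon formula `((u^M) : u^N) = (u_{i₀})` for
   monomials in a regular system of parameters (Cossart–Piltant Prop. 2.1 machinery of the tree)
   and the characteristic-`p` congruence `m b ≡ -u_{i₁} D_{i₁} b ⇒ b ∈ (u_{i₁}^t, u_{i₀})`,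
   `p ∣ m + t`.

The statement for the boundary `E` follows from the case `E = Fin d` (fewer log derivations to
test), and is invariant under replacing the `u_j` by the unit multiples `u'_j`.

Log: (1) tested the degenerate cases (`d = 0`, `E = ∅`, `M = 0`: ideal `= R`) and the inseparable
examples of the brief (`k` imperfect, `R` regular non-smooth): no counterexample, because
`𝔪/𝔪² → Ω_{S_𝔮/ℤ} ⊗ κ` is injective over the prime field (Cohen), so `Der_ℤ(R)` is always
rich enough; (2) completion-free proof as above.
-/

set_option linter.dupNamespace false

namespace Summit.ResolutionOfSingularities.ResolutionOfSingularities.Theorems.PfaffLine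

open IsLocalRing Literature.AlgebraicGeometry.Resolution
open Literature.AlgebraicGeometry.Resolution.CossartPiltant (uPow)

/-! ## Presenting the local ring of a model -/

/-- **The local ring of a finitely generated model is essentially of finite type**: there is a
ring homomorphism `Φ : k[X_1, …, X_n] → A_𝔭` (through `A = k[x_1, …, x_n]`) such that every
element of `A_𝔭` is a fraction `Φ(F)/Φ(G)` with `Φ(G)` a unit. [folklore] -/
theorem exists_presentation {k K : Type} [Field k] [Field K] [Algebra k K]
    (O : ValuationSubring K) (A : Subalgebra k K) (h : A.toSubring ≤ O.toSubring) (hfg : A.FG) :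
    ∃ (n : ℕ) (Φ : MvPolynomial (Fin n) k →+*
      Localization.AtPrime (Ideal.comap (Subring.inclusion h) (IsLocalRing.maximalIdeal O))),
      ∀ r, ∃ F G, IsUnit (Φ G) ∧ r * Φ G = Φ F := by
  classical
  obtain ⟨s, hs⟩ := hfg
  set xs : Fin s.card → K := fun i => ((s.equivFin.symm i : s) : K) with hxs
  have hrange : Set.range xs = (s : Set K) := by
    ext x
    constructor
    · rintro ⟨i, rfl⟩
      exact (s.equivFin.symm i).2
    · intro hx
      exact ⟨s.equivFin ⟨x, hx⟩, by simp [hxs]⟩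
  have hA : (MvPolynomial.aeval (R := k) xs).range = A := by
    rw [MvPolynomial.aeval_range, hrange, hs]
  have hmem : ∀ F, MvPolynomial.aeval (R := k) xs F ∈ A := fun F =>
    hA ▸ (MvPolynomial.aeval (R := k) xs).mem_range_self F
  have hsurjA : ∀ a : A.toSubring, ∃ F, MvPolynomial.aeval (R := k) xs F = (a : K) := fun a => by
    have ha : (a : K) ∈ (MvPolynomial.aeval (R := k) xs).range := by rw [hA]; exact a.2
    exact (AlgHom.mem_range _).mp ha
  let π₀ : MvPolynomial (Fin s.card) k →+* A.toSubring :=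
    { toFun := fun F => ⟨MvPolynomial.aeval (R := k) xs F, hmem F⟩
      map_one' := Subtype.ext (map_one _)
      map_mul' := fun a b => Subtype.ext (map_mul _ a b)
      map_zero' := Subtype.ext (map_zero _)
      map_add' := fun a b => Subtype.ext (map_add _ a b) }
  have hπ₀ : ∀ F, (π₀ F : K) = MvPolynomial.aeval (R := k) xs F := fun F => rfl
  set 𝔭 := Ideal.comap (Subring.inclusion h) (IsLocalRing.maximalIdeal O) with h𝔭
  refine ⟨s.card, (algebraMap A.toSubring (Localization.AtPrime 𝔭)).comp π₀, fun r => ?_⟩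
  obtain ⟨⟨a, t⟩, rfl⟩ := IsLocalization.mk'_surjective 𝔭.primeCompl r
  obtain ⟨F, hF⟩ := hsurjA a
  obtain ⟨G, hG⟩ := hsurjA t
  have hFa : π₀ F = a := Subtype.ext (by rw [hπ₀, hF])
  have hGt : π₀ G = t := Subtype.ext (by rw [hπ₀, hG])
  refine ⟨F, G, ?_, ?_⟩
  · rw [RingHom.comp_apply, hGt]
    exact IsLocalization.map_units _ t
  · dsimp only
    rw [RingHom.comp_apply, RingHom.comp_apply, hFa, hGt, IsLocalization.mk'_spec]

/-- **Lifting an essentially surjective map to a surjection from the localization**: if every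
element of the local ring `R` is a fraction `Φ(F)/Φ(G)` with `Φ(G)` a unit, then `Φ` extends to a
SURJECTIVE homomorphism `Φq : S_𝔮 → R`, `𝔮 = Φ⁻¹(𝔪)`. [folklore] -/
theorem exists_surjective_lift {S R : Type*} [CommRing S] [CommRing R] [IsLocalRing R]
    (Φ : S →+* R) (hΦ : ∀ r, ∃ F G, IsUnit (Φ G) ∧ r * Φ G = Φ F) :
    ∃ Φq : Localization.AtPrime (Ideal.comap Φ (maximalIdeal R)) →+* R,
      Function.Surjective Φq ∧ ∀ F, Φq (algebraMap _ _ F) = Φ F := by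
  have hunits : ∀ y : (Ideal.comap Φ (maximalIdeal R)).primeCompl, IsUnit (Φ y) := fun y => by
    by_contra hy
    exact y.2 ((mem_maximalIdeal _).mpr hy)
  refine ⟨IsLocalization.lift hunits, fun r => ?_, fun F => IsLocalization.lift_eq hunits F⟩
  obtain ⟨F, G, hG, hr⟩ := hΦ r
  have hGq : G ∈ (Ideal.comap Φ (maximalIdeal R)).primeCompl := fun hmem =>
    (mem_maximalIdeal _).mp hmem hG
  refine ⟨IsLocalization.mk' _ F ⟨G, hGq⟩, ?_⟩
  refine (hG.mul_left_inj).mp ?_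
  rw [hr, ← IsLocalization.lift_eq (S := Localization.AtPrime (Ideal.comap Φ (maximalIdeal R)))
    hunits G, ← map_mul]
  change IsLocalization.lift hunits (IsLocalization.mk' _ F ⟨G, hGq⟩ *
    algebraMap _ _ ((⟨G, hGq⟩ : (Ideal.comap Φ (maximalIdeal R)).primeCompl) : S)) = Φ F
  rw [IsLocalization.mk'_spec, IsLocalization.lift_eq]

/-! ## The abstract statement for a regular local ring essentially of finite type -/

/-- **`p`-th powers modulo a monomial, for a regular local quotient of `k[X]_𝔮`.** Let
`Φq : k[X]_𝔮 ↠ R` be surjective with `R` regular local, `p = char k` prime, `u : Fin d → R`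
generators of `𝔪` with `d = dim R`. If `δ a ∈ (∏_{i∈E} u_i^{M_i})` for every `ℤ`-derivation `δ`
of `R` with `δ u_i ∈ (u_i)` for `i ∈ E`, then `a - c^p ∈ (∏_{i∈E} u_i^{M_i})` for some `c`.
[folklore] -/
theorem exists_sub_pow_mem_of_surjective {k : Type} [Field k] {p : ℕ} (hp : p.Prime) [CharP k p]
    {n : ℕ} {R : Type} [CommRing R] [Algebra ℤ R] (hreg : IsRegularLocalRing R)
    (𝔮 : Ideal (MvPolynomial (Fin n) k)) [𝔮.IsPrime] (Φq : Localization.AtPrime 𝔮 →+* R)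
    (hsurj : Function.Surjective Φq) (hpR : (p : R) = 0) (a : R) {d : ℕ} (u : Fin d → R)
    (E : Finset (Fin d)) (M : Fin d → ℕ) (hspan : Ideal.span (Set.range u) = maximalIdeal R)
    (hdim : ringKrullDim R = (d : WithBot ℕ∞))
    (ha : ∀ δ : Derivation ℤ R R, (∀ i ∈ E, δ (u i) ∈ Ideal.span {u i}) →
      δ a ∈ Ideal.span {E.prod fun i => u i ^ M i}) :
    ∃ c : R, a - c ^ p ∈ Ideal.span {E.prod fun i => u i ^ M i} := by
  classical
  haveI : Fact p.Prime := ⟨hp⟩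
  -- `u` is a regular system of parameters
  have hu : IsRsopPart u := ⟨hreg, 0, Fin.elim0, by simpa using hdim, by
    rw [show Set.range (Fin.elim0 : Fin 0 → R) = ∅ from Set.range_eq_empty _, Set.union_empty,
      hspan]⟩
  -- polynomial lifts `F_j` of unit multiples `u'_j = Φ F_j` of the `u_j`
  have hrep : ∀ j, ∃ (F : MvPolynomial (Fin n) k) (v : R), IsUnit v ∧
      Φq (algebraMap _ _ F) = u j * v := fun j => by
    obtain ⟨z, hz⟩ := hsurj (u j)
    obtain ⟨⟨F, s⟩, rfl⟩ := IsLocalization.mk'_surjective 𝔮.primeCompl z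
    refine ⟨F, Φq (algebraMap _ _ (s : MvPolynomial (Fin n) k)),
      (IsLocalization.map_units _ s).map Φq, ?_⟩
    rw [← hz, ← map_mul]
    dsimp only
    rw [IsLocalization.mk'_spec]
  choose F v hv hFv using hrep
  obtain ⟨u', hu'def⟩ : ∃ u' : Fin d → R, ∀ j, u' j = u j * v j := ⟨_, fun _ => rfl⟩
  simp only [← hu'def] at hFv
  have hass : ∀ j, Associated (u j) (u' j) := fun j => by
    rw [hu'def]
    exact (associated_mul_unit_right (u j) _ (hv j))
  have hu' : IsRsopPart u' := hu.of_associated hass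
  have hspan' : Ideal.span (Set.range u') = maximalIdeal R := by
    rw [← Ideal.span_range_eq_of_associated hass, hspan]
  have hspan_i : ∀ i, Ideal.span {u' i} = Ideal.span {u i} := fun i =>
    (hu'def i) ▸ Ideal.span_singleton_mul_right_unit (hv i) (u i)
  have hu'm : ∀ j, u' j ∈ maximalIdeal R := fun j => hspan' ▸ Ideal.subset_span ⟨j, rfl⟩
  have hFm : ∀ j, Φq (algebraMap _ _ (F j)) ∈ maximalIdeal R := fun j => (hFv j) ▸ hu'm j
  -- the classes of the `u'_j` form a basis of `𝔪/𝔪²`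
  have hliF : LinearIndependent (ResidueField R) fun j =>
      (maximalIdeal R).toCotangent ⟨_, hFm j⟩ := by
    have hfin : Module.finrank (ResidueField R) (CotangentSpace R) = d := by
      have h1 := (IsRegularLocalRing.iff_finrank_cotangentSpace R).mp hreg
      rw [hdim] at h1
      exact_mod_cast h1
    refine linearIndependent_of_top_le_span_of_card_eq_finrank ?_ (by rw [Fintype.card_fin, hfin])
    -- the `u'_j` generate `𝔪`, so their classes span `𝔪/𝔪²`
    have heq : (fun j => (maximalIdeal R).toCotangent ⟨_, hFm j⟩) =
        fun j => (maximalIdeal R).toCotangent ⟨u' j, hu'm j⟩ :=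
      funext fun j => congrArg _ (Subtype.ext (hFv j))
    rw [heq]
    have hs : Set.range (fun j => (maximalIdeal R).toCotangent ⟨u' j, hu'm j⟩) =
        (maximalIdeal R).toCotangent '' Set.range (fun j => (⟨u' j, hu'm j⟩ : maximalIdeal R)) := by
      rw [← Set.range_comp]
      rfl
    rw [hs, top_le_iff, CotangentSpace.span_image_eq_top_iff]
    apply Submodule.map_injective_of_injective (maximalIdeal R).injective_subtype
    rw [Submodule.map_span, Submodule.map_top, Submodule.range_subtype, ← Set.range_comp]
    exact hspan'
  -- dual derivations, richness, base case
  obtain ⟨D, hD⟩ := exists_dual_derivations k n 𝔮 Φq hsurj F hFm hliF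
  have hD' : ∀ i j, D i (u' j) = if i = j then 1 else 0 := fun i j => by
    rw [← hFv]; exact hD i j
  have hbase := exists_sub_pow_mem_of_rich hp hpR hu' D hD'
    (fun N _ ψ δ₀ hl Y => exists_derivations_sum_eq k n 𝔮 Φq hsurj p N ψ δ₀ hl Y)
  -- full boundary, unit multiples
  set M' : Fin d → ℕ := fun i => if i ∈ E then M i else 0 with hM'
  have hmono : Ideal.span {uPow u' M'} = Ideal.span {E.prod fun i => u i ^ M i} := by
    have h1 : uPow u' M' = (E.prod fun i => u i ^ M i) * ∏ j, v j ^ M' j := by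
      rw [uPow]
      simp only [hu'def, mul_pow, Finset.prod_mul_distrib]
      congr 1
      rw [← Finset.prod_subset (Finset.subset_univ E) (fun i _ hi => by simp [hM', hi])]
      exact Finset.prod_congr rfl fun i hi => by simp [hM', hi]
    rw [h1]
    exact Ideal.span_singleton_mul_right_unit (IsUnit.prod_univ_iff.mpr fun j => (hv j).pow _) _
  have ha' : ∀ δ : Derivation ℤ R R, (∀ i, δ (u' i) ∈ Ideal.span {u' i}) →
      δ a ∈ Ideal.span {uPow u' M'} := by
    intro δ hδ
    rw [hmono]
    refine ha δ fun i _ => ?_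
    have hw : u i = u' i * ↑(hv i).unit⁻¹ := by
      rw [hu'def, mul_assoc, IsUnit.mul_val_inv, mul_one]
    rw [← hspan_i i, hw, Derivation.leibniz, smul_eq_mul, smul_eq_mul]
    exact Ideal.add_mem _ (Ideal.mul_mem_right _ _ (Ideal.mem_span_singleton_self _))
      (Ideal.mul_mem_left _ _ (hδ i))
  obtain ⟨c, hc⟩ := exists_sub_pow_mem_span_uPow (hu := hu') (hp := hp) (hpR := hpR) (D := D)
    (hD := hD') (hbase := hbase) M' a ha'
  rw [hmono] at hc
  exact ⟨c, hc⟩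

/-! ## The stub -/

/-- **Stub `stub_pthPowerModMonomial`** of line `pfaff-line-log-final-forms` (crux
`Valuative.LuAlphaPTorsor`, `stmt-ResolutionOfSingularities-0641`): at the centre of a finitely
generated model `A ⊆ O` that is regular there, with `u` a regular system of parameters of
`R = A_𝔭`, a boundary `E` and exponents `M`: if every log-derivative of `a` (value at `a` of a
`ℤ`-derivation of `R` with `δ u_i ∈ (u_i)` for `i ∈ E`) lies in `(∏_{i∈E} u_i^{M_i})`, then
`a ≡ c^p mod ∏_{i∈E} u_i^{M_i}` for some `c ∈ R`. Instance of
`exists_sub_pow_mem_of_surjective` through the presentation `k[X]_𝔮 ↠ A_𝔭`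
(`exists_presentation`, `exists_surjective_lift`). [folklore] -/
theorem stub_pthPowerModMonomial :
    ∀ p : ℕ, p.Prime → ∀ (k K : Type) [Field k] [CharP k p] [Field K] [Algebra k K] (O : ValuationSubring K) (A : Subalgebra k K) (h : A.toSubring ≤ O.toSubring), A.FG → IsRegularLocalRing (Localization.AtPrime (Ideal.comap (Subring.inclusion h) (IsLocalRing.maximalIdeal O))) → ∀ (a : Localization.AtPrime (Ideal.comap (Subring.inclusion h) (IsLocalRing.maximalIdeal O))) (d : ℕ) (u : Fin d → Localization.AtPrime (Ideal.comap (Subring.inclusion h) (IsLocalRing.maximalIdeal O))) (E : Finset (Fin d)) (M : Fin d → ℕ), Ideal.span (Set.range u) = IsLocalRing.maximalIdeal (Localization.AtPrime (Ideal.comap (Subring.inclusion h) (IsLocalRing.maximalIdeal O))) ∧ ringKrullDim (Localization.AtPrime (Ideal.comap (Subring.inclusion h) (IsLocalRing.maximalIdeal O))) = (d : WithBot ℕ∞) → Ideal.span {b | ∃ δ : Derivation ℤ (Localization.AtPrime (Ideal.comap (Subring.inclusion h) (IsLocalRing.maximalIdeal O))) (Localization.AtPrime (Ideal.comap (Subring.inclusion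 h) (IsLocalRing.maximalIdeal O))), (∀ i ∈ E, δ (u i) ∈ Ideal.span {u i}) ∧ δ (a) = b} ≤ Ideal.span {E.prod fun i => u i ^ M i} → ∃ c : Localization.AtPrime (Ideal.comap (Subring.inclusion h) (IsLocalRing.maximalIdeal O)), a - c ^ p ∈ Ideal.span {E.prod fun i => u i ^ M i} := by
  intro p hp k K _ _ _ _ O A h hfg hreg a d u E M hud hcontent
  obtain ⟨hspan, hdim⟩ := hud
  -- characteristic `p` descends `k → K ⊇ A → A_𝔭`
  have hpK : (p : K) = 0 := by
    rw [← map_natCast (algebraMap k K) p, CharP.cast_eq_zero k p, map_zero]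
  have hpA : (p : A.toSubring) = 0 := Subtype.ext (by simpa using hpK)
  have hpR : (p : Localization.AtPrime (Ideal.comap (Subring.inclusion h)
      (IsLocalRing.maximalIdeal O))) = 0 := by
    rw [← map_natCast (algebraMap A.toSubring (Localization.AtPrime (Ideal.comap
      (Subring.inclusion h) (IsLocalRing.maximalIdeal O)))) p, hpA, map_zero]
  -- presentation `k[X]_𝔮 ↠ A_𝔭`
  obtain ⟨n, Φ, hΦ⟩ := exists_presentation O A h hfg
  obtain ⟨Φq, hsurj, -⟩ := exists_surjective_lift Φ hΦ
  exact exists_sub_pow_mem_of_surjective hp hreg _ Φq hsurj hpR a u E M hspan hdim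
    fun δ hδ => hcontent (Ideal.subset_span ⟨δ, hδ, rfl⟩)

end Summit.ResolutionOfSingularities.ResolutionOfSingularities.Theorems.PfaffLine
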